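import Literature.Analysis.ODE.CompactSupportFlow
import Mathlib.Analysis.ODE.Gronwall
import Mathlib.Analysis.Calculus.MeanValue
import Mathlib.Analysis.Normed.Group.Bounded
import Mathlib.Analysis.Asymptotics.SpecificAsymptotics

/-!
# The level-preserving shear flow: straightening the handle core against a level hypersurface

Topic `Geometry/Riemannian` (fact seat
`provefact-Literature.Geometry.Riemannian.LawsonMichelsohn1984_surrounding`).  Everything here
is **proved**; no definitions.

In Lawson–Michelsohn's handle theorem (Thm. 3.1) the descending disc `Dᵖ` meets the mean-convex
boundary `Σ = {f = a}` transversally along the attaching sphere and *"by a small perturbation we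
may assume that `Dᵖ` meets `∂X` orthogonally"*.  In the tree the disc is the plane `{y⃗ = 0}` of
a Morse chart of `f`, and the perturbation has to **preserve `f` exactly** (so that the chart
keeps Milnor's normal form) and to have a **prescribed differential along the sphere**.  Both are
delivered by the time-one map `Λ` of the flow of `Z = (f - a) B`, `B` a compactly supported field
tangent to the levels of `f` (`df(B) = 0`):

* `exists_shear_diffeomorph` — `Λ` is a `C^∞` diffeomorphism of `E` with `f ∘ Λ = f`,
  `Λ = id` (and `Λ⁻¹ = id`) wherever `f = a` or `B = 0`, and **at every point `s` of the level
  `{f = a}`, `DΛ(s) = id + B(s) ⊗ df(s)`** — a shear transverse to the level, by which the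
  tangent plane of the disc at `s` can be turned onto the normal of `Σ`.  (The field vanishes at
  `s` with nilpotent linearisation `N = B(s) ⊗ df(s)`, `N² = 0`; the deviation of the flow from
  the linear flow `I + tN` satisfies `φ' = N φ + O(‖z - s‖²)`, and Grönwall's inequality gives
  `‖Λ z - s - (I + N)(z - s)‖ = O(‖z - s‖²)`.)

## References

* H. B. Lawson, Jr., M.-L. Michelsohn, *Embedding and surrounding with positive mean curvature*,
  Invent. Math. 77 (1984), proof of Thm. 3.1. [LawsonMichelsohn1984]
* S. Lang, *Differential and Riemannian Manifolds* (1995), Ch. IV §1 (flows). [Lang1995]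
-/

noncomputable section

open Set Function Filter Metric Asymptotics
open scoped Topology Manifold ContDiff NNReal

namespace Literature.Geometry.Riemannian

open Literature.Analysis.ODE

universe u

variable {E : Type u} [NormedAddCommGroup E] [NormedSpace ℝ E] [FiniteDimensional ℝ E]

/-- `gronwallBound 0 K ε 1` is linear in `ε`: it is `ε` times a constant depending on `K` only.
[folklore] -/
theorem gronwallBound_zero_delta_one_le (K ε : ℝ) :
    ∃ G : ℝ, 0 ≤ G ∧ (∀ ε', gronwallBound 0 K ε' 1 = ε' * G) ∧ gronwallBound 0 K ε 1 ≤ ε * G := by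
  by_cases hK : K = 0
  · refine ⟨1, zero_le_one, fun ε' => ?_, ?_⟩
    · rw [hK, gronwallBound_K0]; simp
    · rw [hK, gronwallBound_K0]; simp
  · refine ⟨(Real.exp K - 1) / K, ?_, fun ε' => ?_, ?_⟩
    · rcases lt_or_gt_of_ne hK with h | h
      · exact div_nonneg_of_nonpos (by linarith [Real.exp_le_one_iff.2 h.le, Real.add_one_le_exp K]) h.le
      · exact div_nonneg (by linarith [Real.add_one_le_exp K]) h.le
    · rw [gronwallBound_of_K_ne_0 hK]; simp [mul_one]; ring
    · rw [gronwallBound_of_K_ne_0 hK]; simp [mul_one]; exact le_of_eq (by ring)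

/-- **The level-preserving shear flow.**  Let `f : E → ℝ` and `B : E → E` be `C^∞` on the
finite-dimensional space `E`, `B` compactly supported and tangent to the levels of `f`
(`df(z)(B z) = 0` for all `z`), and `a ∈ ℝ`.  Then there is a `C^∞` diffeomorphism `Λ` of `E`
(the time-one map of the flow of `Z = (f - a) B`) with: `f ∘ Λ = f`; `Λ z = z` and `Λ⁻¹ z = z`
whenever `f z = a` or `B z = 0`; and `DΛ(s) = id + B(s) ⊗ df(s)` at every `s` with `f s = a`.
[cite: LawsonMichelsohn1984, proof of Thm. 3.1] -/
theorem exists_shear_diffeomorph {f : E → ℝ} (hf : ContDiff ℝ ∞ f) (a : ℝ) {B : E → E}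
    (hB : ContDiff ℝ ∞ B) (hBcs : HasCompactSupport B) (htan : ∀ z, fderiv ℝ f z (B z) = 0) :
    ∃ Λ : E ≃ₘ⟮𝓘(ℝ, E), 𝓘(ℝ, E)⟯ E,
      (∀ z, f (Λ z) = f z) ∧ (∀ z, f z = a ∨ B z = 0 → Λ z = z) ∧
      (∀ z, f z = a ∨ B z = 0 → Λ.symm z = z) ∧
      ∀ s, f s = a → HasFDerivAt Λ
        (ContinuousLinearMap.id ℝ E + (fderiv ℝ f s).smulRight (B s)) s := by
  haveI : CompleteSpace E := FiniteDimensional.complete ℝ E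
  -- the field `Z = (f - a) B`
  set Z : E → E := fun z => (f z - a) • B z with hZ
  have hZc : ContDiff ℝ ∞ Z := (hf.sub contDiff_const).smul hB
  have hZd : Differentiable ℝ Z := hZc.differentiable (by simp)
  have hfd : Differentiable ℝ f := hf.differentiable (by simp)
  have hBd : Differentiable ℝ B := hB.differentiable (by simp)
  have hZcs : HasCompactSupport Z := hBcs.smul_left
  obtain ⟨K, hK⟩ := hZc.lipschitzWith_of_hasCompactSupport hZcs (by simp)
  obtain ⟨L, hL⟩ := hZcs.exists_bound_of_continuous hZc.continuous
  set θ : E → ℝ → E := globalFlow hK hL with hθ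
  have hθ0 : ∀ z, θ z 0 = z := fun z => globalFlow_zero hK hL z
  have hθder : ∀ z t, HasDerivAt (θ z) (Z (θ z t)) t := fun z t => hasDerivAt_globalFlow hK hL z t
  have hθc : ContDiff ℝ ∞ fun p : E × ℝ => θ p.1 p.2 :=
    contDiff_globalFlow (n := (⊤ : ℕ∞)) hZc le_top hK hL
  have hθfix : ∀ z, Z z = 0 → ∀ t, θ z t = z := fun z hz t => globalFlow_eq_self_of_eq_zero hK hL hz t
  have hZ0 : ∀ z, f z = a ∨ B z = 0 → Z z = 0 := by
    rintro z (h | h)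
    · simp [hZ, h]
    · simp [hZ, h]
  -- the time-`t` maps are smooth
  have hθt : ∀ t : ℝ, ContDiff ℝ ∞ fun z => θ z t := fun t =>
    hθc.comp (contDiff_id.prodMk contDiff_const)
  -- the diffeomorphism
  let Λ : E ≃ₘ⟮𝓘(ℝ, E), 𝓘(ℝ, E)⟯ E :=
    { toFun := fun z => θ z 1
      invFun := fun z => θ z (-1)
      left_inv := fun z => globalFlow_neg_globalFlow hK hL z 1
      right_inv := fun z => by
        have h := globalFlow_neg_globalFlow hK hL z (-1)
        rwa [neg_neg] at h
      contMDiff_toFun := contMDiff_iff_contDiff.2 (hθt 1)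
      contMDiff_invFun := contMDiff_iff_contDiff.2 (hθt (-1)) }
  have hΛ : ∀ z, Λ z = θ z 1 := fun z => rfl
  have hΛs : ∀ z, Λ.symm z = θ z (-1) := fun z => rfl
  -- `f` is constant along the flow
  have hfθ : ∀ z t, f (θ z t) = f z := by
    intro z t
    have hd : ∀ u, HasDerivAt (fun u => f (θ z u)) 0 u := fun u => by
      have h := (hfd (θ z u)).hasFDerivAt.comp_hasDerivAt u (hθder z u)
      have h0 : fderiv ℝ f (θ z u) (Z (θ z u)) = 0 := by
        rw [hZ]; dsimp only; rw [map_smul, htan, smul_zero]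
      rwa [h0] at h
    have hdiff : Differentiable ℝ fun u => f (θ z u) := fun u => (hd u).differentiableAt
    have := is_const_of_deriv_eq_zero hdiff (fun u => (hd u).deriv) t 0
    rw [this, hθ0]
  refine ⟨Λ, fun z => by rw [hΛ]; exact hfθ z 1, fun z hz => by rw [hΛ]; exact hθfix z (hZ0 z hz) 1,
    fun z hz => by rw [hΛs]; exact hθfix z (hZ0 z hz) (-1), fun s hs => ?_⟩
  -- the differential at a point of the level
  have hZs : Z s = 0 := hZ0 s (Or.inl hs)
  set N : E →L[ℝ] E := (fderiv ℝ f s).smulRight (B s) with hN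
  have hNapp : ∀ w, N w = (fderiv ℝ f s w) • B s := fun w => rfl
  have hN2 : ∀ w, N (N w) = 0 := fun w => by
    rw [hNapp, hNapp, map_smul, htan s, smul_eq_mul, mul_zero, zero_smul]
  -- `DZ(s) = N`
  have hDZs : HasFDerivAt Z N s := by
    have h1 : HasFDerivAt (fun z => f z - a) (fderiv ℝ f s) s := (hfd s).hasFDerivAt.sub_const a
    have h2 := h1.smul (hBd s).hasFDerivAt
    have e : (f s - a) • fderiv ℝ B s + (fderiv ℝ f s).smulRight (B s) = N := by
      rw [hs, sub_self, zero_smul, zero_add]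
    rw [e] at h2
    exact h2
  -- (A) Taylor remainder: `‖Z w - N (w - s)‖ ≤ C ‖w - s‖²` near `s`
  have hDZ1 : ContDiffAt ℝ 1 (fderiv ℝ Z) s :=
    (hZc.contDiffAt.fderiv_right (m := 1) (by norm_cast)).of_le le_rfl
  obtain ⟨K', U, hU, hlip⟩ := hDZ1.exists_lipschitzOnWith
  obtain ⟨ρ, hρ, hρU⟩ := Metric.mem_nhds_iff.1 hU
  have htaylor : ∀ w ∈ ball s ρ, ‖Z w - N (w - s)‖ ≤ K' * ‖w - s‖ ^ 2 := by
    intro w hw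
    -- MVT for `ζ = Z - N` on the closed ball of radius `‖w - s‖`
    set ζ : E → E := fun z => Z z - N z with hζ
    have hζd : ∀ z, DifferentiableAt ℝ ζ z := fun z => (hZd z).sub (N.differentiableAt)
    have hζD : ∀ z, fderiv ℝ ζ z = fderiv ℝ Z z - N := fun z => by
      rw [hζ]; exact fderiv_sub (hZd z) N.differentiableAt |>.trans (by rw [ContinuousLinearMap.fderiv])
    have hball : closedBall s ‖w - s‖ ⊆ ball s ρ := closedBall_subset_ball (by rwa [mem_ball_iff_norm] at hw)
    have hbound : ∀ z ∈ closedBall s ‖w - s‖, ‖fderiv ℝ ζ z‖ ≤ K' * ‖w - s‖ := by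
      intro z hz
      rw [hζD, ← hDZs.fderiv]
      have h := hlip.norm_sub_le (hρU (hball hz)) (hρU (mem_ball_self hρ))
      refine h.trans (mul_le_mul_of_nonneg_left ?_ K'.coe_nonneg)
      rwa [mem_closedBall_iff_norm] at hz
    have hmvt := (convex_closedBall s ‖w - s‖).norm_image_sub_le_of_norm_fderiv_le
      (fun z _ => hζd z) hbound (mem_closedBall_self (norm_nonneg _))
      (mem_closedBall_iff_norm.2 le_rfl)
    have e : ζ w - ζ s = Z w - N (w - s) := by
      rw [hζ]; dsimp only; rw [hZs, map_sub]; abel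
    rw [e] at hmvt
    calc ‖Z w - N (w - s)‖ ≤ K' * ‖w - s‖ * ‖w - s‖ := hmvt
      _ = K' * ‖w - s‖ ^ 2 := by ring
  -- (B) the flow stays close to the fixed point `s`
  have hθs : ∀ t, θ s t = s := hθfix s hZs
  have hflow : ∀ z, ∀ t ∈ Icc (0 : ℝ) 1, ‖θ z t - s‖ ≤ ‖z - s‖ * Real.exp (K * t) := by
    intro z t ht
    have h := dist_le_of_trajectories_ODE (v := fun _ => Z) (K := K) (f := θ z) (g := fun _ => s)
      (a := 0) (b := 1) (δ := dist z s) (fun _ => hK)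
      (continuous_globalFlow hK hL z).continuousOn
      (fun u _ => (hθder z u).hasDerivWithinAt) continuousOn_const
      (fun u _ => by rw [hZs]; exact (hasDerivAt_const u s).hasDerivWithinAt)
      (by rw [hθ0]) t ht
    rwa [dist_eq_norm, dist_eq_norm, sub_zero] at h
  -- (C) Grönwall for the deviation `φ t = θ z t - z - t • N (z - s)`
  obtain ⟨G, hG0, hGlin, -⟩ := gronwallBound_zero_delta_one_le ‖N‖ 0
  set ρ₁ : ℝ := ρ / (2 * Real.exp K) with hρ₁
  have hρ₁pos : 0 < ρ₁ := by positivity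
  set C₂ : ℝ := K' * Real.exp K ^ 2 * G with hC₂
  have hkey : ∀ z, ‖z - s‖ < ρ₁ → ‖θ z 1 - s - (z - s) - N (z - s)‖ ≤ C₂ * ‖z - s‖ ^ 2 := by
    intro z hz
    -- the trajectory stays in `ball s ρ` for `t ∈ [0, 1]`
    have hin : ∀ t ∈ Icc (0 : ℝ) 1, θ z t ∈ ball s ρ := by
      intro t ht
      rw [mem_ball_iff_norm]
      have h1 := hflow z t ht
      have h2 : Real.exp (K * t) ≤ Real.exp K := Real.exp_le_exp.2 (by nlinarith [ht.1, ht.2, K.coe_nonneg])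
      have h3 : ‖z - s‖ * Real.exp (K * t) ≤ ρ₁ * Real.exp K :=
        mul_le_mul hz.le h2 (Real.exp_pos _).le hρ₁pos.le
      have h4 : ρ₁ * Real.exp K = ρ / 2 := by rw [hρ₁]; field_simp
      linarith
    set φ : ℝ → E := fun t => θ z t - z - t • N (z - s) with hφ
    have hφ0 : φ 0 = 0 := by rw [hφ]; simp [hθ0]
    have hφder : ∀ t, HasDerivAt φ (Z (θ z t) - N (z - s)) t := fun t => by
      have h1 := ((hθder z t).sub_const z).sub ((hasDerivAt_id t).smul_const (N (z - s)))
      rw [one_smul] at h1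
      exact h1
    -- `φ' = N φ + (Z(θ) - N(θ - s))`
    have hsplit : ∀ t, Z (θ z t) - N (z - s) = N (φ t) + (Z (θ z t) - N (θ z t - s)) := by
      intro t
      have e1 : φ t = (θ z t - s) - (z - s) - t • N (z - s) := by rw [hφ]; dsimp only; abel
      have hNφ : N (φ t) = N (θ z t - s) - N (z - s) := by
        rw [e1, N.map_sub (θ z t - s - (z - s)) (t • N (z - s)), N.map_sub (θ z t - s) (z - s),
          map_smul, hN2, smul_zero, sub_zero]
      rw [hNφ]
      abel
    set ε : ℝ := K' * Real.exp K ^ 2 * ‖z - s‖ ^ 2 with hε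
    have hbound : ∀ t ∈ Ico (0 : ℝ) 1, ‖Z (θ z t) - N (z - s)‖ ≤ ‖N‖ * ‖φ t‖ + ε := by
      intro t ht
      rw [hsplit t]
      refine (norm_add_le _ _).trans (add_le_add (N.le_opNorm _) ?_)
      have h1 := htaylor _ (hin t (Ico_subset_Icc_self ht))
      have h2 := hflow z t (Ico_subset_Icc_self ht)
      have h3 : Real.exp (K * t) ≤ Real.exp K := Real.exp_le_exp.2 (by nlinarith [ht.1, ht.2, K.coe_nonneg])
      have h4 : ‖θ z t - s‖ ≤ ‖z - s‖ * Real.exp K := h2.trans (mul_le_mul_of_nonneg_left h3 (norm_nonneg _))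
      calc ‖Z (θ z t) - N (θ z t - s)‖ ≤ K' * ‖θ z t - s‖ ^ 2 := h1
        _ ≤ K' * (‖z - s‖ * Real.exp K) ^ 2 :=
            mul_le_mul_of_nonneg_left (pow_le_pow_left₀ (norm_nonneg _) h4 2) K'.coe_nonneg
        _ = ε := by rw [hε]; ring
    have hgron := norm_le_gronwallBound_of_norm_deriv_right_le (f := φ)
      (f' := fun t => Z (θ z t) - N (z - s)) (δ := 0) (K := ‖N‖) (ε := ε) (a := 0) (b := 1)
      (fun t _ => (hφder t).continuousAt.continuousWithinAt)
      (fun t _ => (hφder t).hasDerivWithinAt) (by rw [hφ0, norm_zero]) hbound 1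
      ⟨zero_le_one, le_rfl⟩
    rw [sub_zero, hGlin] at hgron
    have e : θ z 1 - s - (z - s) - N (z - s) = φ 1 := by rw [hφ]; dsimp only; rw [one_smul]; abel
    rw [e]
    calc ‖φ 1‖ ≤ ε * G := hgron
      _ = C₂ * ‖z - s‖ ^ 2 := by rw [hε, hC₂]; ring
  -- (D) the derivative
  have hΛs' : Λ s = s := by rw [hΛ]; exact hθs 1
  rw [hasFDerivAt_iff_isLittleO_nhds_zero]
  have hbig : (fun h : E => Λ (s + h) - Λ s - (ContinuousLinearMap.id ℝ E + N) h) =O[𝓝 0]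
      fun h : E => ‖h‖ ^ 2 := by
    refine IsBigO.of_bound C₂ ?_
    filter_upwards [Metric.ball_mem_nhds (0 : E) hρ₁pos] with h hh
    have hh' : ‖(s + h) - s‖ < ρ₁ := by simpa using hh
    have hk := hkey (s + h) hh'
    rw [hΛ, hΛs']
    have e : θ (s + h) 1 - s - (ContinuousLinearMap.id ℝ E + N) h =
        θ (s + h) 1 - s - ((s + h) - s) - N ((s + h) - s) := by
      have e' : (ContinuousLinearMap.id ℝ E + N) h = h + N h := rfl
      rw [e', add_sub_cancel_left]
      abel
    rw [e, Real.norm_of_nonneg (by positivity)]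
    simpa using hk
  exact hbig.trans_isLittleO (isLittleO_norm_pow_id one_lt_two)

end Literature.Geometry.Riemannian

end
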